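import Summits.ResolutionOfSingularities.ResolutionOfSingularities.Theorems.PurelyInseparableDim4ScopeDynamics
import Summits.ResolutionOfSingularities.ResolutionOfSingularities.Theorems.PurelyInseparableDim4IsolatedScope
import HarnessLib

/-!
# [OURS · res-dim4-pi · F4-C] SCOPE DYNAMICS, part 2a: scope along a spine DIV edge, read on components
  (the classification of the DIV-spine child: in scope / out of scope / isolated)

Cell `res-dim4-pi` (D-0157 DOOR 2, wave 2), seat `res-dim4-p-6`, desk WORD #31 (c); sequel of
`PurelyInseparableDim4ScopeDynamics` §3.  Along a spine DIV edge `s ⟶ s′ = step p {j} j 0 s` (clean `F`,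
permissible divisor: `p ≤ ord_{(x_j)} F`) part 1 gave `J_p⁺(F) = (x_j^p) · J_p⁺(F′)`
(`ScopeDynamics.singLocusIdeal_eq_span_mul_step`).  Read on minimal primes (§1 is the two-line commutative
algebra of `(f)·I` versus `I` at primes avoiding `f`):

* `mem_minimalPrimes_step_iff_of_not_mem` — OFF `V(x_j)` the components of the child's `p`-fold locus are
  EXACTLY the parent's;
* `eq_span_X_of_mem_minimalPrimes` — the parent's components inside `V(x_j)` are `V(x_j)` alone;
* **`inCoordinateScope_step_iff`** — the CHILD IS IN SCOPE iff the PARENT is AND every SURFACING component (a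
  minimal prime of `J_p⁺(F′)` through the origin containing `x_j`) is coordinate; in particular
  `inCoordinateScope_of_step` (scope of the child forces scope of the parent) and `not_inCoordinateScope_step`
  (**blindness is inherited** along spine DIV edges);
* `eq_span_X_of_isIsolated_step` — an ISOLATED child needs a parent whose locus through the origin is the bare
  hyperplane `V(x_j)`.

So along the spine of MODE 1h «in scope» can only be LOST, never regained, and it is lost exactly when a
non-coordinate component surfaces inside the old exceptional hyperplane — which happens already at the first
forced step of the specimen of part 2b (`PurelyInseparableDim4ScopeLoss`).  Scope (honest): spine (`b = 0`)
DIV (`S = {j}`) edges only; translated edges and centres of codimension `≥ 2` have no such product formula.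

[OURS · counted 0 · elementary; AI kernel work, weaker than expert review.]  NOTHING here is a statement about
resolution of singularities; resolution in dimension `≥ 4` / characteristic `p > 0` is NOT proved by anything
in this file.  bears_on: LADDER-RESOLUTION:D157-DOOR2 (res-dim4-pi · F4-C SCOPE DYNAMICS).
Host item (DR-157-C): `stmt-ResolutionOfSingularities-16155`.
-/

noncomputable section

set_option linter.dupNamespace false -- mandated namespace of this single-conjunct summit

open MvPolynomial Finset

namespace Summit.ResolutionOfSingularities.ResolutionOfSingularities.Theorems.PIDim4

namespace ScopeDynamics

open Literature.AlgebraicGeometry.Resolution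
open Literature.AlgebraicGeometry.Resolution.CentreBlowup
open Literature.AlgebraicGeometry.Resolution.Hauser2010

variable {K : Type} [Field K]

/-! ## §1 `(f)·I` versus `I` at primes avoiding `f` -/

section Dictionary

variable {R : Type*} [CommSemiring R]

/-- A minimal prime of `I` avoiding `f` is a minimal prime of `(f)·I`. [folklore] -/
theorem mem_minimalPrimes_span_mul_of_not_mem {I P : Ideal R} {f : R} (hP : P ∈ I.minimalPrimes)
    (hf : f ∉ P) : P ∈ (Ideal.span {f} * I).minimalPrimes := by
  refine ⟨⟨hP.1.1, Ideal.mul_le_left.trans hP.1.2⟩, fun Q hQ hQP => ?_⟩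
  have hfQ : f ∉ Q := fun h => hf (hQP h)
  have hIQ : I ≤ Q :=
    (hQ.1.mul_le.mp hQ.2).resolve_left fun h => hfQ ((Ideal.span_singleton_le_iff_mem _).mp h)
  exact hP.2 ⟨hQ.1, hIQ⟩ hQP

/-- A minimal prime of `(f)·I` avoiding `f` is a minimal prime of `I`. [folklore] -/
theorem mem_minimalPrimes_of_span_mul_of_not_mem {I P : Ideal R} {f : R}
    (hP : P ∈ (Ideal.span {f} * I).minimalPrimes) (hf : f ∉ P) : P ∈ I.minimalPrimes := by
  have hIP : I ≤ P :=
    (hP.1.1.mul_le.mp hP.1.2).resolve_left fun h => hf ((Ideal.span_singleton_le_iff_mem _).mp h)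
  exact ⟨⟨hP.1.1, hIP⟩, fun Q hQ hQP => hP.2 ⟨hQ.1, Ideal.mul_le_left.trans hQ.2⟩ hQP⟩

/-- A minimal prime of `I` lying over a prime `Q ⊇ I` is `Q`. [folklore] -/
theorem eq_of_mem_minimalPrimes_of_le {I P Q : Ideal R} (hP : P ∈ I.minimalPrimes) (hQ : Q.IsPrime)
    (hIQ : I ≤ Q) (hQP : Q ≤ P) : P = Q :=
  le_antisymm (hP.2 ⟨hQ, hIQ⟩ hQP) hQP

end Dictionary

/-! ## §2 The DIV-spine child: components, scope, isolation -/


/-- **The parent's components inside `V(x_j)` are `V(x_j)` alone**: for a permissible divisor `{x_j}`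
(`q ≤ ord_{(x_j)} F`) a minimal prime of `J_q⁺(F)` containing `x_j` is `(x_j)`. [folklore] -/
theorem eq_span_X_of_mem_minimalPrimes {q : ℕ} {j : Fin 4} {F : MvPolynomial (Fin 4) K}
    (hperm : (q : ℕ∞) ≤ ordAlong {j} F) {P : Ideal (MvPolynomial (Fin 4) K)}
    (hP : P ∈ (singLocusIdeal q F).minimalPrimes) (hXP : (X j : MvPolynomial (Fin 4) K) ∈ P) :
    P = Ideal.span ((fun i => (X i : MvPolynomial (Fin 4) K)) '' (({j} : Finset (Fin 4)) : Set (Fin 4))) := by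
  refine eq_of_mem_minimalPrimes_of_le hP (Literature.RingTheory.MvPolynomial.isPrime_span_X_image _)
    (IsolatedScope.singLocusIdeal_le_span_X hperm) ?_
  rw [Ideal.span_le]
  rintro _ ⟨i, hi, rfl⟩
  rw [Finset.coe_singleton, Set.mem_singleton_iff] at hi
  subst hi
  exact hXP

section DivEdge

variable [DecidableEq K] (p : ℕ) [Fact p.Prime] [CharP K p]

/-- **Off `V(x_j)` the child's components are the parent's**: along a spine DIV edge a prime avoiding `x_j`
is a minimal prime of `J_p⁺(F′)` iff it is one of `J_p⁺(F)`. [folklore] -/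
theorem mem_minimalPrimes_step_iff_of_not_mem {j : Fin 4} (s : State K)
    (hclean : deletePthPowers p s.F = s.F) (hperm : (p : ℕ∞) ≤ ordAlong {j} s.F)
    {P : Ideal (MvPolynomial (Fin 4) K)} (hXP : (X j : MvPolynomial (Fin 4) K) ∉ P) :
    P ∈ (singLocusIdeal p (CentreBlowup.step p {j} j (0 : Fin 4 → K) s).F).minimalPrimes ↔
      P ∈ (singLocusIdeal p s.F).minimalPrimes := by
  rw [ScopeDynamics.singLocusIdeal_eq_span_mul_step p s hclean hperm]
  have hfP : P.IsPrime → (X j : MvPolynomial (Fin 4) K) ^ p ∉ P := fun hPp h =>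
    hXP (hPp.mem_of_pow_mem p h)
  exact ⟨fun hP => mem_minimalPrimes_span_mul_of_not_mem hP (hfP hP.1.1),
    fun hP => mem_minimalPrimes_of_span_mul_of_not_mem hP (hfP hP.1.1)⟩

/-- **Scope of the child forces scope of the parent** (spine DIV edge). [folklore] -/
theorem inCoordinateScope_of_step {j : Fin 4} (s : State K)
    (hclean : deletePthPowers p s.F = s.F) (hperm : (p : ℕ∞) ≤ ordAlong {j} s.F)
    (h : InCoordinateScope p (CentreBlowup.step p {j} j (0 : Fin 4 → K) s).F) :
    InCoordinateScope p s.F := by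
  intro P hP hP0
  by_cases hXP : (X j : MvPolynomial (Fin 4) K) ∈ P
  · exact ⟨{j}, eq_span_X_of_mem_minimalPrimes hperm hP hXP⟩
  · exact h P ((mem_minimalPrimes_step_iff_of_not_mem p s hclean hperm hXP).mpr hP) hP0

/-- **Blindness is inherited along spine DIV edges.** [folklore] -/
theorem not_inCoordinateScope_step {j : Fin 4} (s : State K)
    (hclean : deletePthPowers p s.F = s.F) (hperm : (p : ℕ∞) ≤ ordAlong {j} s.F)
    (h : ¬ InCoordinateScope p s.F) :
    ¬ InCoordinateScope p (CentreBlowup.step p {j} j (0 : Fin 4 → K) s).F :=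
  fun h' => h (inCoordinateScope_of_step p s hclean hperm h')

/-- **CLASSIFICATION OF THE DIV-SPINE CHILD**: the child is in coordinate scope iff the parent is AND every
SURFACING component — a minimal prime of `J_p⁺(F′)` through the origin containing `x_j` — is coordinate.
[folklore] -/
theorem inCoordinateScope_step_iff {j : Fin 4} (s : State K)
    (hclean : deletePthPowers p s.F = s.F) (hperm : (p : ℕ∞) ≤ ordAlong {j} s.F) :
    InCoordinateScope p (CentreBlowup.step p {j} j (0 : Fin 4 → K) s).F ↔
      InCoordinateScope p s.F ∧
        ∀ P ∈ (singLocusIdeal p (CentreBlowup.step p {j} j (0 : Fin 4 → K) s).F).minimalPrimes,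
          P ≤ originIdeal K → (X j : MvPolynomial (Fin 4) K) ∈ P → IsCoordinateIdeal P := by
  refine ⟨fun h => ⟨inCoordinateScope_of_step p s hclean hperm h, fun P hP hP0 _ => h P hP hP0⟩,
    fun ⟨hs, hnew⟩ P hP hP0 => ?_⟩
  by_cases hXP : (X j : MvPolynomial (Fin 4) K) ∈ P
  · exact hnew P hP hP0 hXP
  · exact hs P ((mem_minimalPrimes_step_iff_of_not_mem p s hclean hperm hXP).mp hP) hP0

/-- **An ISOLATED DIV-spine child needs a bare parent**: if the child is an isolated `p`-fold point, every
component of the parent's locus through the origin is the hyperplane `V(x_j)`. [folklore] -/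
theorem eq_span_X_of_isIsolated_step {j : Fin 4} (s : State K)
    (hclean : deletePthPowers p s.F = s.F) (hperm : (p : ℕ∞) ≤ ordAlong {j} s.F)
    (hiso : IsIsolated p (CentreBlowup.step p {j} j (0 : Fin 4 → K) s).F)
    {P : Ideal (MvPolynomial (Fin 4) K)} (hP : P ∈ (singLocusIdeal p s.F).minimalPrimes)
    (hP0 : P ≤ originIdeal K) :
    P = Ideal.span ((fun i => (X i : MvPolynomial (Fin 4) K)) '' (({j} : Finset (Fin 4)) : Set (Fin 4))) := by
  by_cases hXP : (X j : MvPolynomial (Fin 4) K) ∈ P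
  · exact eq_span_X_of_mem_minimalPrimes hperm hP hXP
  · exfalso
    have hP' := (mem_minimalPrimes_step_iff_of_not_mem p s hclean hperm hXP).mpr hP
    have hPm : P = originIdeal K := hiso.2 P hP' hP0
    exact hXP (hPm ▸ IsolatedScope.X_mem_originIdeal j)

end DivEdge

end ScopeDynamics

end Summit.ResolutionOfSingularities.ResolutionOfSingularities.Theorems.PIDim4

end
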